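import Mathlib
import Summits.CriticalPhenomena.SAWScalingLimit.Theses.SAWWeldingIdentification
import Summits.CriticalPhenomena.SAWScalingLimit.Theorems.SAWWeldingIdentificationWeldingRigidityTransition
import Summits.CriticalPhenomena.SAWScalingLimit.Theorems.SAWWeldingIdentificationWeldingRigidityRays
import Summits.CriticalPhenomena.SAWScalingLimit.Theorems.SAWWeldingIdentificationWeldingRigidityBanks
import Summits.CriticalPhenomena.SAWScalingLimit.Theorems.SAWWeldingIdentificationWeldingRigidityGlue
import Summits.CriticalPhenomena.SAWScalingLimit.Theorems.SAWWeldingIdentificationWeldingRigidityAutomorphism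
import Literature.Probability.RandomPlanarGeometry.SimpleCurveLaws

/-!
# Welding rigidity: a removable simple chord is determined by its conformal welding

Closes item `stmt-CriticalPhenomena-4505` (`WeldingRigidity`) of route
`CriticalPhenomena/SAWWeldingIdentification`: the theorem `weldingRigidity_proof` has exactly the
type `Summit.CriticalPhenomena.SAWScalingLimit.Theses.SAWWeldingIdentification.WeldingRigidity`.

Setting: `Q = (Ω; a, c_L, b, c_R)` a conformal rectangle, `γ, γ'` simple chords of `(Ω; a, b)`
(`γ` conformally removable inside `Ω`), banks `L ⊔ R = Ω ∖ γ`, `L' ⊔ R' = Ω ∖ γ'` with normalised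
uniformisers `φ : (ℍₒ; 0, ∞, s) → (L; a, b, c_L)`, `ψ : (ℍₒ; 0, ∞, -s) → (R; a, b, c_R)` and
`φ', ψ'` likewise, and a common welding `h` on `ℚ₊`: `ψ(s q) = φ(-s h q)`, `ψ'(s q) = φ'(-s h q)`.
Conclusion: `γ = γ'` in `CurveClass ℂ`.

Proof (classical: Jones–Smirnov 2000 §1; Sheffield 2016 §1.4; Pommerenke 1992 Thm. 2.6,
Cor. 2.7), assembled from the support files of this item:
1. `…Banks`: `γ` is a cross-cut and `L, R` are Newman's two sides, Jordan domains with
   `∂L = γ ∪ A_L ∋ c_L`, `∂R = γ ∪ A_R ∋ c_R` (Newman's theorem is PROVED in the tree).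
2. `…Rays`: by Carathéodory (PROVED in the tree) the boundary correspondences send the ray
   `-s·(0,∞)` under `φ` and `s·(0,∞)` under `ψ` onto `γ ∖ {a, b}`.
3. `…Transition`: `T_L = Φ' ∘ Φ⁻¹` (disc extensions) is continuous on `L̄`, equals `φ' ∘ φ⁻¹` on
   `L` and carries `φ̄(x)` to `φ̄'(x)`; likewise `T_R` on `R̄`.
4. `…Glue`: the weldings agree on the dense set `ℚ₊`, so `T_L = T_R` on `γ ∖ {a, b}`; the glued
   map `F` is a continuous bijection `Ω → Ω`, holomorphic off `γ`, with `F(γ°) = γ'°` and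
   `F → a, b, c_L` at `a, b, c_L`.
5. Removability of `γ` (hypothesis) makes `F` holomorphic on `Ω`; `…Automorphism`: a holomorphic
   bijection of `Ω` fixing `a, b, c_L` is the identity (chordal uniformiser + the dilations are the
   only automorphisms of `ℍₒ` fixing `0, ∞`). Hence `γ° = γ'°`, `γ.range = γ'.range`, and simple
   classes with equal trace and source coincide (`CurveClass.eq_of_mem_simple_of_range_eq`).
No new definitions; no named (unproved) facts are used.
-/

noncomputable section

open Set Filter Metric Topology Complex
open UpperHalfPlane (upperHalfPlaneSet)

namespace Summit.CriticalPhenomena.SAWScalingLimit.Theorems.WeldingRigidity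

open Literature.Probability.RandomPlanarGeometry
open Literature.Probability.RandomPlanarGeometry.JordanDomain

/-! ### Assembly: the route item `WeldingRigidity` -/

section Main

open Literature.Topology.PlaneTopology (IsSimpleArc)
open Summit.CriticalPhenomena.SAWScalingLimit.Theses.SAWWeldingIdentification (WeldingRigidity)

/-- **Welding rigidity** (item `stmt-CriticalPhenomena-4505` of route `SAWWeldingIdentification`):
a conformally removable simple chord `γ` of the four-marked Jordan domain
`Q = (Ω; a, c_L, b, c_R)` is determined by its conformal welding on the positive rationals.
Given banks and normalised uniformisers `(φ, ψ)` of `γ` and `(φ', ψ')` of a second simple chord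
`γ'`, with the same sign `s` and a common welding `h` (`ψ(s q) = φ(-s h q)`,
`ψ'(s q) = φ'(-s h q)`, `q ∈ ℚ₊`), the map `F = φ' ∘ φ⁻¹` on `L̄`, `ψ' ∘ ψ⁻¹` on `R̄`
(Carathéodory extensions; the two definitions agree on `γ` because the weldings agree on a dense
set) is a continuous bijection `Ω → Ω`, holomorphic off `γ`, hence — `γ` being removable — a
conformal automorphism of `Ω` fixing the boundary points `a, b, c_L`, hence the identity; so
`γ' = F(γ) = γ` as sets, and simple chords with the same trace and endpoints coincide as curve
classes. Classical: Jones–Smirnov 2000 §1, Sheffield 2016 §1.4; Pommerenke 1992 Thm. 2.6,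
Cor. 2.7. [cite: Sheffield2016, §1.4 (Thms. 1.3–1.4)] -/
theorem weldingRigidity_proof : WeldingRigidity := by
  classical
  intro Q γ γ' s L R L' R' φ ψ φ' ψ' h hγ hγ' hrem hs hb hb' hn hn' hw
  -- the chords as cross-cuts
  obtain ⟨-, hGΩ, hGne, -, haG, hbG⟩ := chord_facts hγ
  obtain ⟨-, hGΩ', hGne', -, haG', hbG'⟩ := chord_facts hγ'
  -- the banks as Jordan domains
  obtain ⟨JL, JR, AL, AR, hJL, hJR, hfL, hfR, hAL, hAR, hAu, hAi, hcL1, hcL2, hcR1, -⟩ :=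
    exists_banks hγ hb
  obtain ⟨JL', JR', AL', AR', hJL', hJR', hfL', hfR', hAL', hAR', hAu', hAi', hcL1', -, hcR1',
    -⟩ := exists_banks hγ' hb'
  subst hJL hJR hJL' hJR'
  obtain ⟨hLR, hLRd, hLo, hRo, -, -, -, -⟩ := hb
  obtain ⟨hLR', hLRd', -, -, -, -, -, -⟩ := hb'
  obtain ⟨hφ0, hφinf, hφs, hψ0, hψinf, hψs⟩ := hn
  obtain ⟨hφ0', hφinf', hφs', hψ0', hψinf', hψs'⟩ := hn'
  -- elementary facts about the marked points
  have hs0 : s ≠ 0 := by rcases hs with rfl | rfl <;> norm_num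
  have hns0 : -s ≠ 0 := neg_ne_zero.2 hs0
  have h10 : Q.pt 1 ≠ Q.pt 0 := fun h => absurd (Q.pt_injective h) (by decide)
  have h12 : Q.pt 1 ≠ Q.pt 2 := fun h => absurd (Q.pt_injective h) (by decide)
  have h30 : Q.pt 3 ≠ Q.pt 0 := fun h => absurd (Q.pt_injective h) (by decide)
  have h32 : Q.pt 3 ≠ Q.pt 2 := fun h => absurd (Q.pt_injective h) (by decide)
  have ha : Q.pt 0 ∉ Q.carrier := pt_notMem_carrier Q 0
  have hbΩ : Q.pt 2 ∉ Q.carrier := pt_notMem_carrier Q 2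
  have hγc : IsClosed γ.range := γ.isCompact_range.isClosed
  have hγc' : IsClosed γ'.range := γ'.isCompact_range.isClosed
  have hγfr : γ.range ∩ frontier Q.carrier ⊆ {Q.pt 0, Q.pt 2} := hγ.2.2.2.2
  have hγfr' : γ'.range ∩ frontier Q.carrier ⊆ {Q.pt 0, Q.pt 2} := hγ'.2.2.2.2
  have hALf : AL ⊆ frontier Q.carrier := hAu ▸ subset_union_left
  have hARf : AR ⊆ frontier Q.carrier := hAu ▸ subset_union_right
  have hALf' : AL' ⊆ frontier Q.carrier := hAu' ▸ subset_union_left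
  have hARf' : AR' ⊆ frontier Q.carrier := hAu' ▸ subset_union_right
  have hGA : ∀ {A : Set ℂ}, A ⊆ frontier Q.carrier → γ.range ∩ A ⊆ {Q.pt 0, Q.pt 2} :=
    fun hA z hz => hγfr ⟨hz.1, hA hz.2⟩
  have hGA' : ∀ {A : Set ℂ}, A ⊆ frontier Q.carrier → γ'.range ∩ A ⊆ {Q.pt 0, Q.pt 2} :=
    fun hA z hz => hγfr' ⟨hz.1, hA hz.2⟩
  have hcLγ : Q.pt 1 ∉ γ.range := fun h => by
    rcases hγfr ⟨h, Q.pt_mem_frontier 1⟩ with h' | h'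
    · exact h10 h'
    · exact h12 h'
  -- rays of the four boundary correspondences
  obtain ⟨-, hφG, -⟩ := bank_rays JL hfL (hGA hALf) hγc hAL.isCompact.isClosed hGne hcL1 h10 h12
    hs0 φ hφ0 hφinf hφs
  obtain ⟨-, hψG, hψsurj⟩ := bank_rays JR hfR (hGA hARf) hγc hAR.isCompact.isClosed hGne hcR1
    h30 h32 hns0 ψ hψ0 hψinf (by rw [ofReal_neg]; exact hψs)
  obtain ⟨-, hψG', hψsurj'⟩ := bank_rays JR' hfR' (hGA' hARf') hγc' hAR'.isCompact.isClosed
    hGne' hcR1' h30 h32 hns0 ψ' hψ0' hψinf' (by rw [ofReal_neg]; exact hψs')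
  have hrayψ : ∀ x : ℝ, 0 < s * x → ψ.boundaryExtension x ∈ γ.range \ {Q.pt 0, Q.pt 2} :=
    fun x hx => hψG x (by rwa [neg_mul, neg_lt_zero])
  have hsurjψ : ∀ z ∈ γ.range \ {Q.pt 0, Q.pt 2}, ∃ x : ℝ, 0 < s * x ∧
      ψ.boundaryExtension x = z := fun z hz => by
    obtain ⟨x, hx, hxz⟩ := hψsurj z hz
    exact ⟨x, by rwa [neg_mul, neg_lt_zero] at hx, hxz⟩
  have hrayψ' : ∀ x : ℝ, 0 < s * x → ψ'.boundaryExtension x ∈ γ'.range \ {Q.pt 0, Q.pt 2} :=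
    fun x hx => hψG' x (by rwa [neg_mul, neg_lt_zero])
  have hsurjψ' : ∀ z ∈ γ'.range \ {Q.pt 0, Q.pt 2}, ∃ x : ℝ, 0 < s * x ∧
      ψ'.boundaryExtension x = z := fun z hz => by
    obtain ⟨x, hx, hxz⟩ := hψsurj' z hz
    exact ⟨x, by rwa [neg_mul, neg_lt_zero] at hx, hxz⟩
  -- the two transition maps
  obtain ⟨TL, hTLc, -, hTLeq, hTLx, hTLinf⟩ := exists_transition JL JL' φ φ'
  obtain ⟨TR, hTRc, -, hTReq, hTRx, hTRinf⟩ := exists_transition JR JR' ψ ψ'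
  -- they agree on the chord (the weldings agree on `ℚ₊`)
  have hGL : γ.range \ {Q.pt 0, Q.pt 2} ⊆ closure JL.carrier := fun z hz =>
    frontier_subset_closure (hfL ▸ Or.inl hz.1)
  have hGR : γ.range \ {Q.pt 0, Q.pt 2} ⊆ closure JR.carrier := fun z hz =>
    frontier_subset_closure (hfR ▸ Or.inl hz.1)
  have hagree : EqOn TL TR (γ.range \ {Q.pt 0, Q.pt 2}) :=
    eqOn_of_welding (eφ := fun y : ℝ => φ.boundaryExtension y)
      (eψ := fun x : ℝ => ψ.boundaryExtension x) (eφ' := fun y : ℝ => φ'.boundaryExtension y)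
      (eψ' := fun x : ℝ => ψ'.boundaryExtension x) hs hTLc hGL
      (continuous_boundaryExtension_ofReal ψ) (continuous_boundaryExtension_ofReal ψ') hTLx hTRx
      hrayψ hsurjψ fun q hq => ⟨(hw q hq).2.1, (hw q hq).2.2⟩
  -- the glued map
  set F : ℂ → ℂ := JL.carrier.piecewise TL TR with hF
  have hfrL : Q.carrier ∩ frontier JL.carrier ⊆ γ.range := by
    rintro z ⟨hzΩ, hz⟩
    rw [hfL] at hz
    rcases hz with hz | hz
    · exact hz
    · exact absurd hzΩ (fun h => (hALf hz).2 (by rwa [Q.isOpen.interior_eq]))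
  have hFc : ContinuousOn F Q.carrier :=
    continuousOn_glued hLR ha hbΩ hLo hfrL hGR hTLc hTRc hagree
  have hTLd : DifferentiableOn ℂ TL JL.carrier :=
    (φ'.differentiableOn_coe.comp φ.symm.differentiableOn_coe φ.symm_mapsTo).congr hTLeq
  have hTRd : DifferentiableOn ℂ TR JR.carrier :=
    (ψ'.differentiableOn_coe.comp ψ.symm.differentiableOn_coe ψ.symm_mapsTo).congr hTReq
  have hFd : DifferentiableOn ℂ F (Q.carrier \ γ.range) :=
    differentiableOn_glued hLR hLRd hLo hRo hTLd hTRd hagree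
  have hTLb : BijOn TL JL.carrier JL'.carrier :=
    (φ'.bijOn.comp φ.symm.bijOn).congr hTLeq.symm
  have hTRb : BijOn TR JR.carrier JR'.carrier :=
    (ψ'.bijOn.comp ψ.symm.bijOn).congr hTReq.symm
  have hψinj' : Function.Injective fun x : ℝ => ψ'.boundaryExtension x :=
    boundaryExtension_ofReal_injective ψ'
  have hFi : InjOn F Q.carrier :=
    injOn_glued (X := {x : ℝ | 0 < s * x}) hLR hLRd ha hbΩ hLR' hLRd' hTLb hTRb hTRx hψinj'
      hrayψ hsurjψ hrayψ'
  have hFs : F '' Q.carrier = Q.carrier :=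
    image_glued (X := {x : ℝ | 0 < s * x}) hLR hLRd ha hbΩ hLR' hGΩ hGΩ' hTLb hTRb hTRx hrayψ
      hsurjψ hrayψ' hsurjψ'
  have hFG : F '' (γ.range \ {Q.pt 0, Q.pt 2}) = γ'.range \ {Q.pt 0, Q.pt 2} :=
    image_chord_glued (X := {x : ℝ | 0 < s * x}) hLR hTRx hrayψ hsurjψ hrayψ' hsurjψ'
  -- removability of `γ`: `F` is holomorphic on `Ω`
  have hFhol : DifferentiableOn ℂ F Q.carrier := hrem F hFc hFi hFs hFd
  -- boundary limits of `F` at `a`, `b`, `c_L`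
  have hΩE : Q.carrier ⊆ (JL.carrier ∪ γ.range \ {Q.pt 0, Q.pt 2}) ∪ JR.carrier := fun z hz => by
    rcases mem_cases hLR ha hbΩ hz with h | h | h
    · exact Or.inl (Or.inl h)
    · exact Or.inr h
    · exact Or.inl (Or.inr h)
  have hE : JL.carrier ∪ γ.range \ {Q.pt 0, Q.pt 2} ⊆ closure JL.carrier :=
    union_subset subset_closure hGL
  have hFL : EqOn F TL (JL.carrier ∪ γ.range \ {Q.pt 0, Q.pt 2}) := glued_eq_left hagree
  have hFR : EqOn F TR JR.carrier := glued_eq_right hLRd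
  have hTLa : TL (Q.pt 0) = Q.pt 0 :=
    calc TL (Q.pt 0) = TL (φ.boundaryExtension ((0 : ℝ) : ℂ)) := by
          rw [boundaryExtension_zero_eq φ hφ0]
      _ = φ'.boundaryExtension ((0 : ℝ) : ℂ) := hTLx 0
      _ = Q.pt 0 := boundaryExtension_zero_eq φ' hφ0'
  have hTRa : TR (Q.pt 0) = Q.pt 0 :=
    calc TR (Q.pt 0) = TR (ψ.boundaryExtension ((0 : ℝ) : ℂ)) := by
          rw [boundaryExtension_zero_eq ψ hψ0]
      _ = ψ'.boundaryExtension ((0 : ℝ) : ℂ) := hTRx 0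
      _ = Q.pt 0 := boundaryExtension_zero_eq ψ' hψ0'
  have hTLcL : TL (Q.pt 1) = Q.pt 1 :=
    calc TL (Q.pt 1) = TL (φ.boundaryExtension (s : ℂ)) := by
          rw [boundaryExtension_ofReal_eq_of_hasBoundaryValue φ hφs]
      _ = φ'.boundaryExtension (s : ℂ) := hTLx s
      _ = Q.pt 1 := boundaryExtension_ofReal_eq_of_hasBoundaryValue φ' hφs'
  have hcLR : Q.pt 1 ∉ closure JR.carrier := by
    rw [closure_eq_self_union_frontier, hfR]
    rintro (h | h | h)
    · exact pt_notMem_carrier Q 1 ((bank_subset hLR).2 h).1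
    · exact hcLγ h
    · exact hcL2 h
  have hFa : Tendsto F (𝓝[Q.carrier] (Q.pt 0)) (𝓝 (Q.pt 0)) :=
    tendsto_glued hΩE hE hFL hFR hTLc hTRc (fun _ => hTLa) (fun _ => hTRa)
  have hFb : Tendsto F (𝓝[Q.carrier] (Q.pt 2)) (𝓝 (Q.pt 2)) :=
    tendsto_glued hΩE hE hFL hFR hTLc hTRc (fun _ => hTLinf _ _ hφinf hφinf')
      (fun _ => hTRinf _ _ hψinf hψinf')
  have hFcL : Tendsto F (𝓝[Q.carrier] (Q.pt 1)) (𝓝 (Q.pt 1)) :=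
    tendsto_glued hΩE hE hFL hFR hTLc hTRc (fun _ => hTLcL) (fun h => absurd h hcLR)
  -- `F` is the identity
  have hid : EqOn F id Q.carrier :=
    eqOn_id_of_tendsto_three (Q.chord 0 2 (by decide)) (c := Q.pt 1) (Q.pt_mem_frontier 1)
      h10 h12 hFhol hFi hFs hFa hFb hFcL
  -- hence `γ` and `γ'` have the same trace, hence coincide
  have hGG : γ.range \ {Q.pt 0, Q.pt 2} = γ'.range \ {Q.pt 0, Q.pt 2} := by
    rw [← hFG, (hid.mono hGΩ).image_eq, image_id]
  have hab : ({Q.pt 0, Q.pt 2} : Set ℂ) ⊆ γ.range :=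
    insert_subset_iff.2 ⟨haG, singleton_subset_iff.2 hbG⟩
  have hab' : ({Q.pt 0, Q.pt 2} : Set ℂ) ⊆ γ'.range :=
    insert_subset_iff.2 ⟨haG', singleton_subset_iff.2 hbG'⟩
  have hrange : γ.range = γ'.range := by
    rw [← Set.sdiff_union_of_subset hab, hGG, Set.sdiff_union_of_subset hab']
  exact CurveClass.eq_of_mem_simple_of_range_eq hγ.1 hγ'.1 hrange (hγ.2.1.trans hγ'.2.1.symm)

end Main

end Summit.CriticalPhenomena.SAWScalingLimit.Theorems.WeldingRigidity
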